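import Summits.BirchSwinnertonDyer.BirchSwinnertonDyer.Theorems.CountingDoorF2AtThreeSchneiderOnDoorSubfamilyClassCongruences
import Summits.BirchSwinnertonDyer.BirchSwinnertonDyer.Theorems.CountingDoorF2AtThreeSchneiderOnDoorSubfamilyHeightDigitsKernel
import Summits.BirchSwinnertonDyer.BirchSwinnertonDyer.Theorems.CountingDoorF2AtThreeSieveClassFamily
import Literature.NumberTheory.EllipticCurves.CanonicalPAdicHeightThreeAdicDigitProofs
import HarnessLib

/-!
# BirchSwinnertonDyer / CountingDoorF2AtThree — crux I4loc `SchneiderOnDoorSubfamily`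
# (stmt-BirchSwinnertonDyer-19682), line `valuation-class-at-three` (v3): **STUB 1 `stub_heightDigits`**
# — the digit certificate `(d_A, d_B) = (1, 2)` for EVERY member of the class `a ≡ (7,0,4,0) (mod 9)`

Stub file (`--supports stmt-BirchSwinnertonDyer-19682`; proves the REGISTERED v3 stub `stub_heightDigits` of
`Cruxes/SchneiderOnDoorSubfamily/Lines/valuation_class_at_three.lean` by name and signature; cell bsd-rank2,
seat cd-valclass-digits = STUB 1 owner; PARTITION: none — r_an ≥ 2, summit axis S0; B1: `3`-adic height
algebra on two explicit points of an explicit family, nothing reads an analytic rank; no S0 motion).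

`Theorems.params_heightDigits_of_class`: for a member `a` of `F₂` with `a ≡ (7,0,4,0) (mod 9)`, square-free-sieved
discriminant (`ℓ² ∤ Δ(a)` at every prime: type ∅) and `ψ₂(P₁) = a₁a₂ + a₃ ≠ 0`, and for EVERY canonical
`3`-adic height datum `Dh` on `a.curve`, the three clauses of the registered v3 stub hold with
`(d_A, d_B) = (1, 2)`:
`‖⟨2P₁,2P₁⟩/3 − 1‖₃ < 1`, `‖⟨3P₂,3P₂⟩/3 − 2‖₃ < 1`, `‖⟨2P₁+3P₂, 2P₁+3P₂⟩‖₃ ≤ 3⁻¹`, `1·2 % 3 = 2`.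
NO sigma-existence hypothesis: if `a.curve ⊗ ℚ₃` has a Mazur–Tate pair the digits come from the
second-order evaluation `‖⟨nP,nP⟩ − log₃ φₙ(P)‖ ≤ ‖ψₙ(P)‖²` (cd-valclass-sigma3, p458151) and the class
congruences `φ₂(P₁) ≡ 4`, `φ₃(P₂) ≡ 7`, `ψ₂(P₁) ≡ 0`, `ψ₃(P₂) ≡ 6 (mod 9)` (cd-valclass-denom, p458899);
if it has none, NO datum is canonical (`PAdicHeightData.not_isCanonical_of_not_exists_pair`, this seat,
p459247: the junk sigma formula is not even while a pairing is), so the clause is vacuous. The cross term is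
cd-valclass-denom's `params_norm_pairing_crossTerm_le` (p458150).

`CountingDoorF2AtThreeSchneiderOnDoorSubfamilyStubHeightDigits.stub_heightDigits` = THE REGISTERED STUB: the
family is cd-bridge-loc's `Theorems.exists_sieveClassFamily_star` (p460134: `Φ = F₂ ∩ {a ≡ (7,0,4,0) mod 9}
∩ {≡ (1,0,1,0) mod 25} ∩ {≡ (1,2,4,3) mod 7} ∩ {ℓ² ∤ Δ(a), ℓ ∉ {3,5,7}}`, large, nonempty residues, member
`a* = (−524, 450, −374, 3825)`, local door conditions, square-free sieve at every prime), and on it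
`ψ₂(P₁) = a₁a₂ + a₃ ≡ 5 (mod 7)` is nonzero (cd-valclass-denom), so the member-level certificate applies to
every member. With `stub_transport` (cd-transport) this closes the crux through the v3 composition
`SchneiderOnDoorSubfamily_of` (kernel: eng-2's `schneiderConjecture_of_nonresidue_digits`, p452361).

References: Mazur–Stein–Tate 2006 §1, Alg. 3.4 [MazurSteinTate2006]; Balakrishnan 2016 §2
[Balakrishnan2016]; Harvey 2008 §5 [Harvey2008]; Bhargava–Ho 2022 §1 [BhargavaHo2022].
-/

set_option linter.dupNamespace false

noncomputable section

open scoped Classical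
open WeierstrassCurve Literature.NumberTheory.EllipticCurves
  Literature.NumberTheory.EllipticCurves.BhargavaHo2022

namespace Summit.BirchSwinnertonDyer.BirchSwinnertonDyer.Theorems

variable (a : Params)

/-! ### Residue bookkeeping -/

/-- `(x : ZMod 9) = c ⇒ (x : ZMod 3) = c`. [folklore] -/
theorem intCast_zmod_three_of_zmod_nine {x : ℤ} {c : ℤ} (h : (x : ZMod 9) = (c : ZMod 9)) :
    (x : ZMod 3) = (c : ZMod 3) := by
  have := congrArg (ZMod.castHom (show 3 ∣ 9 by norm_num) (ZMod 3)) h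
  rwa [map_intCast, map_intCast] at this

/-- On the class `a₁ ≡ 7 (mod 9)`: `‖a₁‖₃ = 1` (the `a₁` of `a.curve`). [cite: BhargavaHo2022, §1 (definition of F₂)] -/
theorem params_norm_a₁_eq_one (h₁ : (a.a₁ : ZMod 9) = 7) : ‖(a.curve.a₁ : ℚ_[3])‖ = 1 := by
  rw [show a.curve.a₁ = ((a.a₁ : ℤ) : ℚ) from rfl, Rat.cast_intCast]
  refine le_antisymm (Padic.norm_int_le_one _) (not_lt.mp fun hlt => ?_)
  have h3 : (3 : ℤ) ∣ a.a₁ := by exact_mod_cast Padic.norm_intCast_lt_one_iff.mp hlt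
  have h0 : (a.a₁ : ZMod 3) = 0 := (ZMod.intCast_zmod_eq_zero_iff_dvd _ 3).mpr (by exact_mod_cast h3)
  have h1 : (a.a₁ : ZMod 3) = ((7 : ℤ) : ZMod 3) :=
    intCast_zmod_three_of_zmod_nine (by rw [h₁]; push_cast; rfl)
  rw [h0] at h1
  exact absurd h1 (by decide)

/-! ### The member-level certificate -/

/-- **The digit certificate `(d_A, d_B) = (1, 2)` for every member of the class `(7,0,4,0) mod 9`.**
For `a ∈ F₂` with `a ≡ (7,0,4,0) (mod 9)`, `ℓ² ∤ Δ(a)` for every prime `ℓ` (type ∅) and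
`ψ₂(P₁) ≠ 0`, and EVERY canonical `3`-adic height datum `Dh` on `a.curve`:
`‖⟨2P₁,2P₁⟩/3 − 1‖₃ < 1 ∧ ‖⟨3P₂,3P₂⟩/3 − 2‖₃ < 1 ∧ ‖⟨2P₁+3P₂,2P₁+3P₂⟩‖₃ ≤ 3⁻¹` (and `1·2 ≡ 2 mod 3`),
unconditionally (genuine Mazur–Tate branch: second-order sigma evaluation; junk branch: no canonical
datum exists). [cite: MazurSteinTate2006, §1 eq. (1.1) and Alg. 3.4 (steps 1–4)]
[cite: Balakrishnan2016, §2 eq. (2.3)] -/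
theorem params_heightDigits_of_class (h : a.IsMember)
    (hΔ : ∀ ℓ : ℕ, ℓ.Prime → ¬ (ℓ : ℤ) ^ 2 ∣ a.curveInt.Δ)
    (h₁ : (a.a₁ : ZMod 9) = 7) (h₂ : (a.a₂ : ZMod 9) = 0) (h₂' : (a.a₂' : ZMod 9) = 4)
    (h₃ : (a.a₃ : ZMod 9) = 0) (hψ : (a.curveInt.ψ 2).evalEval a.a₂ 0 ≠ 0)
    (Dh : PAdicHeightData a.curve 3) (hDh : Dh.IsCanonical) :
    ∃ dA dB : ℤ, dA * dB % 3 = 2 ∧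
      ‖Dh.pairing (2 • a.markedPoint₁ h) (2 • a.markedPoint₁ h) / 3 - dA‖ < 1 ∧
      ‖Dh.pairing (3 • a.markedPoint₂ h) (3 • a.markedPoint₂ h) / 3 - dB‖ < 1 ∧
      ‖Dh.pairing (2 • a.markedPoint₁ h + 3 • a.markedPoint₂ h)
          (2 • a.markedPoint₁ h + 3 • a.markedPoint₂ h)‖ ≤ (3 : ℝ)⁻¹ := by
  haveI : a.curve.IsIntegral ℤ := params_isIntegral_curve a
  -- residues mod 3
  have g₁ : (a.a₁ : ZMod 3) = 1 := by
    have := intCast_zmod_three_of_zmod_nine (x := a.a₁) (c := 7) (by rw [h₁]; push_cast; rfl)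
    rw [this]; decide
  have g₂ : (a.a₂ : ZMod 3) = 0 := by
    have := intCast_zmod_three_of_zmod_nine (x := a.a₂) (c := 0) (by rw [h₂]; push_cast; rfl)
    rw [this]; push_cast; rfl
  have g₂' : (a.a₂' : ZMod 3) = 1 := by
    have := intCast_zmod_three_of_zmod_nine (x := a.a₂') (c := 4) (by rw [h₂']; push_cast; rfl)
    rw [this]; decide
  have g₃ : (a.a₃ : ZMod 3) = 0 := by
    have := intCast_zmod_three_of_zmod_nine (x := a.a₃) (c := 0) (by rw [h₃]; push_cast; rfl)
    rw [this]; push_cast; rfl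
  -- division values on the class
  have hφ₂ := params_φ_two_markedPoint₁_zmod_nine h₁ h₂ h₂' h₃
  have hφ₃ := params_φ_three_markedPoint₂_zmod_nine h₁ h₂ h₂' h₃
  obtain ⟨hψ₃3, -, hψ₃0⟩ := params_three_dvd_not_nine_dvd_ψ_three_markedPoint₂ h₁ h₂ h₂' h₃
  have hψ₂9 := params_nine_dvd_ψ_two_markedPoint₁ h₂ h₃
  have hψ₂3 : (3 : ℤ) ∣ (a.curveInt.ψ 2).evalEval a.a₂ 0 := (show (3 : ℤ) ∣ 9 by norm_num).trans hψ₂9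
  -- the digit congruences `9 ∣ φ² − 1 − 6d`
  have hdA : (9 : ℤ) ∣ (a.curveInt.φ 2).evalEval a.a₂ 0 ^ 2 - 1 - 6 * 1 := by
    have : ((((a.curveInt.φ 2).evalEval a.a₂ 0 ^ 2 - 1 - 6 * 1 : ℤ)) : ZMod 9) = 0 := by
      push_cast; rw [hφ₂]; decide
    exact_mod_cast (ZMod.intCast_zmod_eq_zero_iff_dvd _ 9).mp this
  have hdB : (9 : ℤ) ∣ (a.curveInt.φ 3).evalEval a.a₂' 0 ^ 2 - 1 - 6 * 2 := by
    have : ((((a.curveInt.φ 3).evalEval a.a₂' 0 ^ 2 - 1 - 6 * 2 : ℤ)) : ZMod 9) = 0 := by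
      push_cast; rw [hφ₃]; decide
    exact_mod_cast (ZMod.intCast_zmod_eq_zero_iff_dvd _ 9).mp this
  have hm₂ : ¬ (3 : ℤ) ∣ (a.curveInt.φ 2).evalEval a.a₂ 0 := by
    intro hd
    have h0 : (((a.curveInt.φ 2).evalEval a.a₂ 0 : ℤ) : ZMod 3) = 0 :=
      (ZMod.intCast_zmod_eq_zero_iff_dvd _ 3).mpr (by exact_mod_cast hd)
    have h4 : (((a.curveInt.φ 2).evalEval a.a₂ 0 : ℤ) : ZMod 3) = ((4 : ℤ) : ZMod 3) :=
      intCast_zmod_three_of_zmod_nine (by rw [hφ₂]; push_cast; rfl)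
    rw [h0] at h4
    exact absurd h4 (by decide)
  -- the cross term (clause 3), for every canonical datum
  have hC := params_norm_pairing_crossTerm_le hΔ h g₁ g₂ g₂' g₃ hDh
  -- clause 1: `2P₁`, first digit `1`, from the FIRST-order bound (level of `2P₁` is ≥ 2 on the class)
  have hA : ‖Dh.pairing (2 • a.markedPoint₁ h) (2 • a.markedPoint₁ h) / 3 - ((1 : ℤ) : ℚ_[3])‖ < 1 :=
    norm_div_three_sub_lt_one_of_norm_sub_padicLog_le hm₂ hdA
      (params_norm_pairing_two_markedPoint₁_sub_log_le hΔ h h₂ h₃ hψ hDh)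
  refine ⟨1, 2, by decide, hA, ?_, hC⟩
  -- clause 2: `3P₂`, first digit `2`; genuine branch needs the Mazur–Tate pair, junk branch is empty
  by_cases hpair : ∃ σ : PowerSeries ℚ_[3], ∃ c : ℚ_[3],
      (a.curve.baseChange ℚ_[3]).IsMazurTateSigmaPair σ c
  · obtain ⟨h', e'⟩ := params_markedPoint₂_eq_some_intCast h
    rw [params_nsmul_eq_zsmul, e']
    have hψ' : (a.curveInt.ψ ((3 : ℕ) : ℤ)).evalEval a.a₂' 0 ≠ 0 := by exact_mod_cast hψ₃0
    have h3' : (3 : ℤ) ∣ (a.curveInt.ψ ((3 : ℕ) : ℤ)).evalEval a.a₂' 0 := by exact_mod_cast hψ₃3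
    have hd' : (9 : ℤ) ∣ (a.curveInt.φ ((3 : ℕ) : ℤ)).evalEval a.a₂' 0 ^ 2 - 1 - 6 * 2 := by
      exact_mod_cast hdB
    have key := a.curveInt.norm_pairing_zsmul_self_three_div_sub_lt hpair hDh h' hΔ hψ' h3' 2 hd'
    exact_mod_cast key
  · exfalso
    obtain ⟨h', e'⟩ := params_markedPoint₁_eq_some_intCast h
    have hadm : a.curve.IsAdmissible 3 ((2 : ℤ) • Affine.Point.some _ _ h') :=
      params_isAdmissible_zsmul_intPoint 3 le_rfl hΔ h' hψ hψ₂3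
    obtain ⟨h₁', e₁⟩ := params_zsmul_intPoint_eq h' hψ
    rw [e₁] at hadm
    have hx := hadm.2.1
    have hns := (Affine.nonsingular_neg (W' := a.curve.toAffine) _ _).mpr h₁'
    have hneg : a.curve.IsAdmissible 3 (-(Affine.Point.some _ _ h₁')) := by
      rw [Affine.Point.neg_some]
      exact a.curve.isAdmissible_of_one_lt_norm le_rfl hns hx fun ℓ hℓ => by
        haveI := Fact.mk hℓ
        exact params_hasNonsingularReductionAt_of_not_sq_dvd a hΔ ℓ hns
    exact PAdicHeightData.not_isCanonical_of_not_exists_pair a.curve (by norm_num)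
      (params_norm_a₁_eq_one a h₁) hpair hadm hneg Dh hDh

end Summit.BirchSwinnertonDyer.BirchSwinnertonDyer.Theorems

/-! ### The registered stub -/

namespace Summit.BirchSwinnertonDyer.BirchSwinnertonDyer.Theorems.CountingDoorF2AtThreeSchneiderOnDoorSubfamilyStubHeightDigits

open Summit.BirchSwinnertonDyer.BirchSwinnertonDyer.Theorems

/-- **STUB 1 (v3) `stub_heightDigits` of the line `valuation-class-at-three` for crux I4loc
`SchneiderOnDoorSubfamily` — PROVED.** There is a large congruence subfamily `Φ` of Bhargava–Ho's `F₂`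
(`Φ = F₂ ∩ {a ≡ (7,0,4,0) mod 9} ∩ {a ≡ (1,0,1,0) mod 25} ∩ {a ≡ (1,2,4,3) mod 7} ∩ {ℓ² ∤ Δ(a), ℓ ∉ {3,5,7}}`,
cd-bridge-loc's `exists_sieveClassFamily_star`) with nonempty residue sets and the member
`a* = (−524, 450, −374, 3825)`, whose members satisfy the local door conditions and the square-free sieve at
every prime, such that for EVERY member and EVERY canonical `3`-adic height datum `Dh` on the member's model
the two-height certificate holds with digits `(d_A, d_B) = (1, 2)`:
`‖⟨2P₁,2P₁⟩/3 − 1‖₃ < 1`, `‖⟨3P₂,3P₂⟩/3 − 2‖₃ < 1`, `‖⟨2P₁+3P₂, 2P₁+3P₂⟩‖₃ ≤ 3⁻¹`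
(`Theorems.params_heightDigits_of_class`). [cite: MazurSteinTate2006, §1 eq. (1.1) and Alg. 3.4 (steps 1–4)]
[cite: BhargavaHo2022, §1 (large subfamilies defined by congruence conditions)] -/
theorem stub_heightDigits :
    ∃ Φ : CongruenceFamily₂, Φ.IsLarge ∧ (∀ p : ℕ, p.Prime → (Φ.residues p).Nonempty) ∧
      (∃ a, Φ.Mem a) ∧
      (∀ a : Params, Φ.Mem a → a.curve.HasIrreducibleModPGaloisRep 3 ∧
        ∀ (C : VariableChange ℚ) (hC : (C • a.curve).IsGloballyMinimal),
          @IsOrdinaryAt (C • a.curve) hC 3 _ ∧ ∃ ℓ : ℕ, ∃ _ : Fact ℓ.Prime, ℓ ≠ 3 ∧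
            (C • a.curve).HasMultiplicativeReductionAtPrime ℓ ∧
            ¬ 3 ∣ padicValInt ℓ (@minimalDiscriminantInt (C • a.curve) hC)) ∧
      (∀ a : Params, Φ.Mem a → ∀ ℓ : ℕ, ℓ.Prime → ¬ ((ℓ : ℤ) ^ 2 ∣ a.curveInt.Δ)) ∧
      ∀ (a : Params) (h : Φ.Mem a) (Dh : PAdicHeightData a.curve 3), Dh.IsCanonical →
        ∃ dA dB : ℤ, dA * dB % 3 = 2 ∧
          ‖Dh.pairing (2 • a.markedPoint₁ h.1) (2 • a.markedPoint₁ h.1) / 3 - dA‖ < 1 ∧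
          ‖Dh.pairing (3 • a.markedPoint₂ h.1) (3 • a.markedPoint₂ h.1) / 3 - dB‖ < 1 ∧
          ‖Dh.pairing (2 • a.markedPoint₁ h.1 + 3 • a.markedPoint₂ h.1)
              (2 • a.markedPoint₁ h.1 + 3 • a.markedPoint₂ h.1)‖ ≤ (3 : ℝ)⁻¹ := by
  obtain ⟨Φ, hL, hne, hmem, hchar, hloc⟩ := exists_sieveClassFamily_star
  refine ⟨Φ, hL, hne, ⟨_, hmem⟩, fun a ha => (hloc a ha).1, fun a ha => (hloc a ha).2.1, ?_⟩
  intro a ha Dh hDh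
  obtain ⟨-, ⟨h₁, h₂, h₂', h₃⟩, -, ⟨s₁, s₂, -, s₃⟩, -⟩ := (hchar a).mp ha
  exact params_heightDigits_of_class a ha.1 (hloc a ha).2.1 h₁ h₂ h₂' h₃
    (params_ψ_two_markedPoint₁_zmod_seven a s₁ s₂ s₃).2 Dh hDh

end Summit.BirchSwinnertonDyer.BirchSwinnertonDyer.Theorems.CountingDoorF2AtThreeSchneiderOnDoorSubfamilyStubHeightDigits


end
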